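import Summits.HubbardSuperconductivity.HubbardSuperconductivity.Theses.AposterioriCapRg

/-!
# Repair kit for the X1-misstated crux `AposterioriOrderCriterionR` (crux-strategist, wall-breaker seat, 2026-08-17)

Crux stmt-HubbardSuperconductivity-13884 (route AposterioriCapRg, rev 34).  Companion of `STRATEGY-CENSUS.md` and
`REPAIR-KIT.md` in this crux directory (all top-level files).  EVIDENCE, NOT A PROPOSAL: nothing here is a Theses/Theorems decl.

WHAT IS WRONG (X1, kernel-checked elsewhere: `Cruxes/…/DrefuteTadpole.lean`, `Literature…tendsto_truncatedTadpole`,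
`Literature…HubbardTruncatedHartree.tendsto_gaussExpect_hubbardInteraction_zero_seed`,
`Literature…HubbardSymmetrisedInteraction.dWaveSourceTorus_add_half_mul_coupling`): R's hypothesis certifies the GRASSMANN
report `hubbardScaleReportCT U μ D h` (plain quartic vertex + symmetric Matsubara truncation ⇒ operator model
`dWaveSourceTorus L U (μ + U/2) h`), its conclusion is the OPERATOR order parameter `dWaveOrderParameter U μ`.

WHAT THIS FILE GIVES THE REPAIR PLANNER (all elaborating; the glue theorems are sorry-free):
* §1 the repaired criterion in the two interchangeable forms
  (a) `R_a`  — Grassmann objects read at `μ - U/2`, operator side at `μ`   (RECOMMENDED: `FixedPointDWaveOrder`, the density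
        clause of [2] and the Statement witness all stay at operator `μ`);
  (b) `R_b`  — Grassmann objects at `μ`, conclusion at `μ + U/2`           (= `Lines/X1Probe.AposterioriOrderCriterionR'`);
  `R_a_iff_R_b` (pure substitution), and the hygiene variant `R_aNp` with `0 < D.numPatches` (VERDICT-c1 §3 / triage X2);
* §2 the matching restatements of [2] `CapRgSymmetricCertificatePinned` and [3] `SeededBrokenRegimeBoseFermiPinned` in form (a)
  (`Item2_a`, `Item3_a`) and form (b) (`Item2_b`, `Item3_b` = X1Probe's), i.e. the ONE coordinated substitution;
* §3 the DECIDING THEOREMS re-proved against the sub-problem Statement itself, for both forms and for the hygiene variant: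
  `closes_a`, `closes_aNp`, `closes_b : [2]′ → [3]′ → R′ → SsbToEvenTorusLro → HubbardSuperconductivity` — drop-in `glue.lean`
  bodies for `ledger route edit … --closes-file` after the three `--restate`s;
* (`RepairKitSigTest.lean`, `RepairKitSignatures.md`: the same item texts as ONE-LINE signatures with fully qualified names, obtained
  from the rev-34 route texts by the literal substitution and checked to elaborate in the route file's import/open context — the strings to
  pass to `ledger workitem add --signature` / `ledger route edit --restate … --statement`);
* §4 the corrected Grassmann→operator transfer every revived line needs, as ONE statement in both readings
  (`MatsubaraBridge_a`, `MatsubaraBridge_b`; drefute's corrected signature, `3 ≤ L`), recommended to be vendored as a cite-tagged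
  Literature NAMED FACT (Giuliani–Mastropietro CMP 293 (2010) (2.6)+App. A; Pedra–Salmhofer CMP 282 (2008) Thm 4.5, §5) — see
  `BridgeInPrint.md`.
-/

set_option linter.dupNamespace false

namespace Summit.HubbardSuperconductivity.HubbardSuperconductivity.Cruxes.AposterioriOrderCriterionR.RepairKit

open Literature.MathematicalPhysics.QuantumLattice Filter
open Summit.HubbardSuperconductivity.HubbardSuperconductivity.Theses.AposterioriCapRg

/-! ## §1 The repaired criterion -/

/-- **R′, form (a)** (recommended): every Grassmann object read at `μ - U/2`, operator side at `μ`. -/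
def R_a : Prop :=
  ∃ kStar etaStar : ℚ, 0 < kStar ∧ 0 < etaStar ∧ ∀ (U μ h₀ : ℝ) (D : HubbardScaleData), 0 < h₀ →
    (∀ h ∈ Set.Ioc (0:ℝ) h₀, ∃ L₀ : ℕ, D.IsCertifiedEnclosure (hubbardScaleReportCT U (μ - U / 2) D h) L₀) →
    D.MeetsThresholds kStar etaStar →
    ((D.meanFieldDensity.fst : ℚ) : ℝ) / 2 ≤ dWaveOrderParameter U μ

/-- **R′, form (b)**: Grassmann objects at `μ`, conclusion at operator `μ + U/2` (X1Probe's `AposterioriOrderCriterionR'`). -/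
def R_b : Prop :=
  ∃ kStar etaStar : ℚ, 0 < kStar ∧ 0 < etaStar ∧ ∀ (U μ h₀ : ℝ) (D : HubbardScaleData), 0 < h₀ →
    (∀ h ∈ Set.Ioc (0:ℝ) h₀, ∃ L₀ : ℕ, D.IsCertifiedEnclosure (hubbardScaleReportCT U μ D h) L₀) →
    D.MeetsThresholds kStar etaStar →
    ((D.meanFieldDensity.fst : ℚ) : ℝ) / 2 ≤ dWaveOrderParameter U (μ + U / 2)

/-- The two forms are the same statement (R′ quantifies over every `μ`; substitute `μ ↦ μ ∓ U/2`). -/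
theorem R_a_iff_R_b : R_a ↔ R_b := by
  constructor
  · rintro ⟨k, e, hk, he, H⟩
    refine ⟨k, e, hk, he, fun U μ h₀ D hh₀ hcert hthr => ?_⟩
    have := H U (μ + U / 2) h₀ D hh₀ (by simpa using hcert) hthr
    simpa using this
  · rintro ⟨k, e, hk, he, H⟩
    refine ⟨k, e, hk, he, fun U μ h₀ D hh₀ hcert hthr => ?_⟩
    have := H U (μ - U / 2) h₀ D hh₀ hcert hthr
    simpa using this

/-- **R′ with the hygiene clause `0 < D.numPatches`** (form (a)); weaker than `R_a`, and still glues because [3] delivers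
`0 < D.numPatches` since rev 20. -/
def R_aNp : Prop :=
  ∃ kStar etaStar : ℚ, 0 < kStar ∧ 0 < etaStar ∧ ∀ (U μ h₀ : ℝ) (D : HubbardScaleData), 0 < h₀ → 0 < D.numPatches →
    (∀ h ∈ Set.Ioc (0:ℝ) h₀, ∃ L₀ : ℕ, D.IsCertifiedEnclosure (hubbardScaleReportCT U (μ - U / 2) D h) L₀) →
    D.MeetsThresholds kStar etaStar →
    ((D.meanFieldDensity.fst : ℚ) : ℝ) / 2 ≤ dWaveOrderParameter U μ

theorem R_aNp_of_R_a (H : R_a) : R_aNp := by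
  obtain ⟨k, e, hk, he, H⟩ := H
  exact ⟨k, e, hk, he, fun U μ h₀ D hh₀ _ hcert hthr => H U μ h₀ D hh₀ hcert hthr⟩

/-! ## §2 The coordinated restatements of [2] and [3] -/

/-- **[2]′, form (a)**: density clause at operator `μ` (verbatim), symmetric-regime certificate read at Grassmann `μ - U/2`. -/
def Item2_a : Prop :=
  ∃ U ∈ Set.Icc (2:ℝ) 3, ∃ δ ∈ Set.Icc (1/5:ℝ) (7/20), ∃ μ : ℝ,
    Tendsto (fun L : ℕ => ((hubbardTorusWith 2 (L + 1) 1 U μ).groundStateFunctional totalNumber).re /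
      ((L + 1 : ℕ) : ℝ) ^ 2) atTop (nhds (1 - δ)) ∧
    ∀ Θ : SymmetricTolerance, ∃ (K : TrigPolyC4v) (Λ : ℝ) (L₀ : ℕ),
      symmetricRegimeCertificateT U (μ - U / 2) capRgCornerDataT Θ K Λ L₀

/-- **[3]′, form (a)**: density hypothesis at operator `μ` (verbatim), certificate hypothesis and report conclusion at
Grassmann `μ - U/2`. -/
def Item3_a : Prop :=
  ∀ kStar etaStar : ℚ, 0 < kStar → 0 < etaStar → ∃ Θ : SymmetricTolerance, ∀ U ∈ Set.Icc (2:ℝ) 3,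
    ∀ δ ∈ Set.Icc (1/5:ℝ) (7/20), ∀ μ : ℝ,
    Tendsto (fun L : ℕ => ((hubbardTorusWith 2 (L + 1) 1 U μ).groundStateFunctional totalNumber).re /
      ((L + 1 : ℕ) : ℝ) ^ 2) atTop (nhds (1 - δ)) →
    ∀ (K : TrigPolyC4v) (Λ : ℝ) (L₀ : ℕ), symmetricRegimeCertificateT U (μ - U / 2) capRgCornerDataT Θ K Λ L₀ →
    ∃ h₀ : ℝ, 0 < h₀ ∧ ∃ D : HubbardScaleData, D.MeetsThresholds kStar etaStar ∧ 0 < D.numPatches ∧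
      0 < D.meanFieldDensity.fst ∧
      ∀ h ∈ Set.Ioc (0:ℝ) h₀, ∃ L₀' : ℕ, D.IsCertifiedEnclosure (hubbardScaleReportCT U (μ - U / 2) D h) L₀'

/-- **[2]′, form (b)** (X1Probe): density clause at operator `μ + U/2`, Grassmann certificate at `μ`. -/
def Item2_b : Prop :=
  ∃ U ∈ Set.Icc (2:ℝ) 3, ∃ δ ∈ Set.Icc (1/5:ℝ) (7/20), ∃ μ : ℝ,
    Tendsto (fun L : ℕ => ((hubbardTorusWith 2 (L + 1) 1 U (μ + U / 2)).groundStateFunctional totalNumber).re /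
      ((L + 1 : ℕ) : ℝ) ^ 2) atTop (nhds (1 - δ)) ∧
    ∀ Θ : SymmetricTolerance, ∃ (K : TrigPolyC4v) (Λ : ℝ) (L₀ : ℕ), symmetricRegimeCertificateT U μ capRgCornerDataT Θ K Λ L₀

/-- **[3]′, form (b)** (X1Probe): density hypothesis at operator `μ + U/2`, Grassmann clauses at `μ`. -/
def Item3_b : Prop :=
  ∀ kStar etaStar : ℚ, 0 < kStar → 0 < etaStar → ∃ Θ : SymmetricTolerance, ∀ U ∈ Set.Icc (2:ℝ) 3,
    ∀ δ ∈ Set.Icc (1/5:ℝ) (7/20), ∀ μ : ℝ,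
    Tendsto (fun L : ℕ => ((hubbardTorusWith 2 (L + 1) 1 U (μ + U / 2)).groundStateFunctional totalNumber).re /
      ((L + 1 : ℕ) : ℝ) ^ 2) atTop (nhds (1 - δ)) →
    ∀ (K : TrigPolyC4v) (Λ : ℝ) (L₀ : ℕ), symmetricRegimeCertificateT U μ capRgCornerDataT Θ K Λ L₀ →
    ∃ h₀ : ℝ, 0 < h₀ ∧ ∃ D : HubbardScaleData, D.MeetsThresholds kStar etaStar ∧ 0 < D.numPatches ∧
      0 < D.meanFieldDensity.fst ∧
      ∀ h ∈ Set.Ioc (0:ℝ) h₀, ∃ L₀' : ℕ, D.IsCertifiedEnclosure (hubbardScaleReportCT U μ D h) L₀'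

/-! ## §3 The deciding theorems, re-proved against the Statement (drop-in `glue.lean` bodies) -/

/-- Step 2 of every `closes`: the thesis X plus the every-ground-state transfer give the Statement (verbatim logic of the
route file's `closes`, step 2). -/
theorem statement_of_fixedPoint (hT : FixedPointDWaveOrder) (hS : SsbToEvenTorusLro) : _root_.HubbardSuperconductivity := by
  obtain ⟨U, hU, δ, hδ, μ, hdens, hord⟩ := hT
  have hU0 : (0 : ℝ) < U := by linarith [hU.1]
  have hδ' : δ ∈ Set.Ioo (0 : ℝ) 1 := ⟨by linarith [hδ.1], by linarith [hδ.2]⟩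
  unfold HubbardSuperconductivity Literature.Hubbard.DWaveSuperconductivityHubbard
  refine ⟨U, hU0, δ, ⟨by linarith [hδ.1], by linarith [hδ.2]⟩, ?_⟩
  intro N ψ hψ
  exact hS U δ μ hU0 hδ' hdens hord N ψ hψ

/-- **Form (a) re-glues by pure logic to the thesis X**, witness `(U, δ, μ)` (operator `μ` throughout). -/
theorem fixedPoint_of_chain_a (h2 : Item2_a) (h3 : Item3_a) (hR : R_a) : FixedPointDWaveOrder := by
  obtain ⟨kStar, etaStar, hk, he, hRall⟩ := hR
  obtain ⟨Θ, h3all⟩ := h3 kStar etaStar hk he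
  obtain ⟨U, hU, δ, hδ, μ, hdens, hcert⟩ := h2
  obtain ⟨K, Λ, L₀, hc⟩ := hcert Θ
  obtain ⟨h₀, hh₀, D, hmeets, _hnp, hm₀, hencl⟩ := h3all U hU δ hδ μ hdens K Λ L₀ hc
  have hle := hRall U μ h₀ D hh₀ hencl hmeets
  have hm₀' : (0 : ℝ) < ((D.meanFieldDensity.fst : ℚ) : ℝ) := by exact_mod_cast hm₀
  refine ⟨U, hU, δ, hδ, μ, hdens, ?_⟩
  rw [hasDWaveOrder_iff]
  linarith

/-- **DECIDING THEOREM, form (a)**: `[2]′ → [3]′ → R′ → SsbToEvenTorusLro → HubbardSuperconductivity`. -/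
theorem closes_a : Item2_a → Item3_a → R_a → SsbToEvenTorusLro → _root_.HubbardSuperconductivity :=
  fun h2 h3 hR hS => statement_of_fixedPoint (fixedPoint_of_chain_a h2 h3 hR) hS

/-- The hygiene variant glues the same way ([3]′ hands over `0 < D.numPatches`). -/
theorem fixedPoint_of_chain_aNp (h2 : Item2_a) (h3 : Item3_a) (hR : R_aNp) : FixedPointDWaveOrder := by
  obtain ⟨kStar, etaStar, hk, he, hRall⟩ := hR
  obtain ⟨Θ, h3all⟩ := h3 kStar etaStar hk he
  obtain ⟨U, hU, δ, hδ, μ, hdens, hcert⟩ := h2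
  obtain ⟨K, Λ, L₀, hc⟩ := hcert Θ
  obtain ⟨h₀, hh₀, D, hmeets, hnp, hm₀, hencl⟩ := h3all U hU δ hδ μ hdens K Λ L₀ hc
  have hle := hRall U μ h₀ D hh₀ hnp hencl hmeets
  have hm₀' : (0 : ℝ) < ((D.meanFieldDensity.fst : ℚ) : ℝ) := by exact_mod_cast hm₀
  refine ⟨U, hU, δ, hδ, μ, hdens, ?_⟩
  rw [hasDWaveOrder_iff]
  linarith

/-- **DECIDING THEOREM, form (a) with hygiene**. -/
theorem closes_aNp : Item2_a → Item3_a → R_aNp → SsbToEvenTorusLro → _root_.HubbardSuperconductivity :=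
  fun h2 h3 hR hS => statement_of_fixedPoint (fixedPoint_of_chain_aNp h2 h3 hR) hS

/-- **Form (b) re-glues by pure logic to the thesis X**, witness `(U, δ, μ + U/2)` (X1Probe's `fixedPoint_of_repairedChain`). -/
theorem fixedPoint_of_chain_b (h2 : Item2_b) (h3 : Item3_b) (hR : R_b) : FixedPointDWaveOrder := by
  obtain ⟨kStar, etaStar, hk, he, hRall⟩ := hR
  obtain ⟨Θ, h3all⟩ := h3 kStar etaStar hk he
  obtain ⟨U, hU, δ, hδ, μ, hdens, hcert⟩ := h2
  obtain ⟨K, Λ, L₀, hc⟩ := hcert Θ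
  obtain ⟨h₀, hh₀, D, hmeets, _hnp, hm₀, hencl⟩ := h3all U hU δ hδ μ hdens K Λ L₀ hc
  have hle := hRall U μ h₀ D hh₀ hencl hmeets
  have hm₀' : (0 : ℝ) < ((D.meanFieldDensity.fst : ℚ) : ℝ) := by exact_mod_cast hm₀
  refine ⟨U, hU, δ, hδ, μ + U / 2, hdens, ?_⟩
  rw [hasDWaveOrder_iff]
  linarith

/-- **DECIDING THEOREM, form (b)**. -/
theorem closes_b : Item2_b → Item3_b → R_b → SsbToEvenTorusLro → _root_.HubbardSuperconductivity :=
  fun h2 h3 hR hS => statement_of_fixedPoint (fixedPoint_of_chain_b h2 h3 hR) hS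

/-- For the record: with the texts AS FILED the same logic proves the Statement from [2], [3], R (the route's `closes`):
the chain is FORMALLY fine; it is R's CONTENT that is cross-filling (STRATEGY-CENSUS.md §0). -/
example : CapRgSymmetricCertificatePinned → SeededBrokenRegimeBoseFermiPinned → AposterioriOrderCriterionR →
    SsbToEvenTorusLro → _root_.HubbardSuperconductivity := closes

/-! ## §4 The Grassmann → operator transfer every revived line needs (one statement, two readings) -/

/-- **The Matsubara bridge, reading (b)** (drefute's corrected signature; `Lines/X1Probe.MatsubaraBridgeShifted`): in a frame
whose scale-`Λ₀` shell is empty, the `M → ∞` limit of the report's mean-field density at Grassmann `μ` is the Gibbs anomalous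
density of `dWaveSourceTorus L U (μ + U/2) h`, for every finite `L ≥ 3`, `β > 0` and EVERY real `U`.  In print modulo
assembly: Giuliani–Mastropietro 2010 (2.6)+(1.1)+App. A (dictionary and order-by-order identification), Pedra–Salmhofer 2008
Thm 4.5/§5 (existence of the Matsubara UV limit at every coupling, finite `β, L`), analytic continuation in `U`. -/
def MatsubaraBridge_b : Prop :=
  ∀ (L : ℕ) [NeZero L] (β U μ h Λ₀ : ℝ) (K' : TrigPolyC4v), 3 ≤ L → 0 < β → 0 < Λ₀ →
    (∀ k : Literature.Probability.LatticeModels.TorusSite 2 L, Λ₀ ≤ |nambuXiCT L μ K' k|) →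
    Tendsto (fun M : ℕ => scaleMeanFieldDensityCT L M β U μ h K' Λ₀) atTop
      (nhds ((Matrix.gibbsState β (dWaveSourceTorus L U (μ + U / 2) h) (pairField dWaveFormFactor L)).re / (L : ℝ) ^ 2))

/-- **The Matsubara bridge, reading (a)**: Grassmann objects at `μ - U/2`, operator Gibbs state at `μ`. -/
def MatsubaraBridge_a : Prop :=
  ∀ (L : ℕ) [NeZero L] (β U μ h Λ₀ : ℝ) (K' : TrigPolyC4v), 3 ≤ L → 0 < β → 0 < Λ₀ →
    (∀ k : Literature.Probability.LatticeModels.TorusSite 2 L, Λ₀ ≤ |nambuXiCT L (μ - U / 2) K' k|) →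
    Tendsto (fun M : ℕ => scaleMeanFieldDensityCT L M β U (μ - U / 2) h K' Λ₀) atTop
      (nhds ((Matrix.gibbsState β (dWaveSourceTorus L U μ h) (pairField dWaveFormFactor L)).re / (L : ℝ) ^ 2))

theorem matsubaraBridge_a_of_b (H : MatsubaraBridge_b) : MatsubaraBridge_a := by
  intro L _ β U μ h Λ₀ K' hL hβ hΛ hshell
  have := H L β U (μ - U / 2) h Λ₀ K' hL hβ hΛ hshell
  simpa using this

/-- What R AS TYPED would need instead — the UNshifted bridge — is false for every `U ≠ 0` (first-order witness
`d/dU|₀[lhs − rhs] = ½∂_μ m_free ≠ 0`, NegativeNotesStubMatsubaraBridge.md; HubbardTruncatedHartree for the tree's own vertex).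
Recorded here only as the statement every dead line carried (`stub_matsubaraBridge`), NOT asserted. -/
def MatsubaraBridge_asTyped_FALSE : Prop :=
  ∀ (L : ℕ) [NeZero L] (β U μ h Λ₀ : ℝ) (K' : TrigPolyC4v), 3 ≤ L → 0 < β → 0 < Λ₀ →
    (∀ k : Literature.Probability.LatticeModels.TorusSite 2 L, Λ₀ ≤ |nambuXiCT L μ K' k|) →
    Tendsto (fun M : ℕ => scaleMeanFieldDensityCT L M β U μ h K' Λ₀) atTop
      (nhds ((Matrix.gibbsState β (dWaveSourceTorus L U μ h) (pairField dWaveFormFactor L)).re / (L : ℝ) ^ 2))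

end Summit.HubbardSuperconductivity.HubbardSuperconductivity.Cruxes.AposterioriOrderCriterionR.RepairKit
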